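import Literature.NumberTheory.PAdicHodge.TateTwistPeriodLine
import HarnessLib

/-!
# `inv_∞` of the connecting class of the cochain `τ ↦ ψ(τ) · ℓ_u`: Kato II §1.4.4–1.4.5 assembled at a completion

Topic `Literature/NumberTheory/PAdicHodge`; THEOREMS ONLY (no definition, no named fact, no instance, no `sorry`). Sequel of
`TateTwistPeriodLine` §5 (`isCoboundaryLift_twistPairingPadic_rootKummerCocycle`: for a unit `u` of a `p`-adic field `F` and a character
cocycle `b`, the `B_dR⁺`-valued cochain `τ ↦ b(τ) · ℓ_u` presents `κ_u ∪ b` through the period line `ι : ℤ_p(1) → B_dR⁺`) and of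
`GaloisCohomology/CupProductMuPadicCharacter` (edix-p4 g17/g18: `invPadic_cupProduct_kummerPadic_eq_neg_mul_of_isCyclotomic`, Kato II
Lemma 1.4.5 at a completion `K_v`, `v ∣ p`, in `ℤ_p`-coefficients).

* §1 (any `p`-adic `F`) `norm_algebraMap_normedAlgClosure_le_one_of_valuation_le_one` (the unit hypothesis of `unitKummerLog` from
  `valuation F u ≤ 1`); ★ `cupProduct_kummerPadic_eq_twoCocycleClass_of_presentation` — **`κ_∞(u) ∪ [b] = [c]` in `H²(F, ℤ_p(1))` for
  EVERY continuous `2`-cocycle `c` presented through `ι` by `τ ↦ b(τ) · ℓ_u`** (class form of file 1 §5 with the LEAD's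
  `oneCocycleClass_rootKummerCocycle : [rootKummerCocycle] = kummerPadic`).
* §2 (a completion `F = K_v`, `v ∣ p`, of a number field `K`; instances of `K_v` as binders) ★★
  `invPadic_twoCocycleClass_eq_neg_mul_of_unitKummerLog_presentation` — for the cyclotomic `ℤ_p`-extension `κ` of `K`, `ψ = a · (κ ∘ res_v)`,
  a unit `u ∈ 𝒪_v` and `σ ∈ Γ_K` with `ε_p(σ) = N_{K_v/ℚ_p}(u)`: **`inv_∞[c] = −a · κ(σ)` for EVERY continuous `2`-cocycle `c` of `ℤ_p(1)`
  presented through `ι` by the `B_dR⁺(K_v)`-valued cochain `τ ↦ ψ(τ) · ℓ_u`** — the calibration constant of Kato's reciprocity law read on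
  cochains (II §1.4.4: `δ[log χ(τ) · ℓ_u] = κ_u ∪ log χ`; Lemma 1.4.5: `inv(κ_u ∪ log χ) = −log χ(rec u)`), in the currency
  (`BdRPlusTop`, `galRepr`, `periodLine`) in which `TatePairingCochainFilOne` presents `η ∪ κ_P`.

Line `kato_lever` of crux K★ `stmt-BirchSwinnertonDyer-22226` ((H5) endpoint); BSD / K★ / [REC] are NOT proved by any of this.

## References
* K. Kato, LNM 1553 (1993), Ch. II §1.4.2, §1.4.4, Lemma 1.4.5. [Kato1993LNM1553]
* S. Bloch, K. Kato (1990), Ex. 3.10.1. [BlochKato1990]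
* J.-P. Serre, *Local Fields* (1979), XIV §1 Prop. 3. [SerreLocalFields1979]
-/

noncomputable section

open Field Function ValuativeRel WittVector NumberField IsDedekindDomain
open scoped NumberField

namespace Literature.NumberTheory.PAdicHodge

open Literature.NumberTheory.GaloisRepresentations
open Literature.NumberTheory.GaloisRepresentations.IsNonarchimedeanLocalField
open Literature.NumberTheory.GaloisCohomology
open Literature.NumberTheory.EllipticCurves

/-! ## §1 Class form over any `p`-adic field -/

section AnyField

variable {F : Type} [Field F] [ValuativeRel F] [TopologicalSpace F] [IsNonarchimedeanLocalField F] [CharZero F]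
  {p : ℕ} [Fact p.Prime] [Fact (¬ IsUnit (p : integerC F))] [IsAdicComplete (Ideal.span {(p : integerC F)}) (integerC F)]

omit [CharZero F] [Fact p.Prime] [Fact (¬ IsUnit (p : integerC F))] [IsAdicComplete (Ideal.span {(p : integerC F)}) (integerC F)] in
/-- `valuation F u ≤ 1 ⇒ ‖u‖_{F̄} ≤ 1` (the unit hypothesis `hu1` of `unitKummerLog`; the absolute value of `F̄` extends that of `F`).
[cite: SerreLocalFields1979, Ch. II §2 Prop. 3] -/
theorem norm_algebraMap_normedAlgClosure_le_one_of_valuation_le_one {u : F} (hu : valuation F u ≤ 1) :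
    ‖algebraMap F (NormedAlgClosure F) u‖ ≤ 1 := by
  rw [NormedAlgClosure.norm_algebraMap]
  exact (valuation_le_one_iff_norm_le_one u).1 hu

variable [LocallyCompactSpace (absoluteGaloisGroup F)]

/-- ★ **`κ_∞(u) ∪ [b] = [c]` for every presentation `c` of `τ ↦ b(τ) · ℓ_u` through the period line** (`u ∈ F`, `0 < |u| ≤ 1`, `b` a
continuous character cocycle): the class form of `isCoboundaryLift_twistPairingPadic_rootKummerCocycle`, with `[rootKummerCocycle] = κ_∞(u)`
(`oneCocycleClass_rootKummerCocycle`). [cite: Kato1993LNM1553, Ch. II §1.4.4] [cite: BlochKato1990, Ex. 3.10.1] -/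
theorem cupProduct_kummerPadic_eq_twoCocycleClass_of_presentation (hp : valuation F p < 1)
    (hF : Function.Surjective (fontaineTheta (integerC F) p)) {u : F} (hu : u ≠ 0)
    (hu1 : ‖algebraMap F (NormedAlgClosure F) u‖ ≤ 1) (b : contOneCocycles (padicTrivRep F p).toTopRep)
    {c : contTwoCocycles (tateModuleMuPadic F p).toTopRep}
    (hc : IsCoboundaryLift (ρ := tateModuleMuPadic F p) (BdRPlusTop.galRepr F p) (BdRPlusTop.periodLine F p)
      (fun τ => BdRPlusTop.of F p (qpToBdR ((b.1 τ : ℤ_[p]) : ℚ_[p])) * BdRPlusTop.unitKummerLog hp hF hu hu1) c) :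
    (twistPairingPadic F p).cupProduct (kummerPadic F p u hu) (oneCocycleClass _ b) = twoCocycleClass _ c := by
  rw [← BdRPlusTop.oneCocycleClass_rootKummerCocycle, ContPairing.cupProduct_oneCocycleClass]
  exact BdRPlusTop.cupClass_rootKummerCocycle_eq_twoCocycleClass hp hF hu hu1 b hc

end AnyField

/-! ## §2 The endpoint at a completion `K_v`, `v ∣ p` -/

section Completion

variable {K : Type} [Field K] [NumberField K] {p : ℕ} [Fact p.Prime] (v : HeightOneSpectrum (𝓞 K))
  [CharZero (v.adicCompletion K)] [Fact (¬ IsUnit (p : integerC (v.adicCompletion K)))]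
  [IsAdicComplete (Ideal.span {(p : integerC (v.adicCompletion K))}) (integerC (v.adicCompletion K))]
  [LocallyCompactSpace (absoluteGaloisGroup (v.adicCompletion K))]

/-- ★★ **Kato II §1.4.4 + Lemma 1.4.5 on cochains, at a completion.** Let `κ : Γ_K ↠ ℤ_p` be the cyclotomic `ℤ_p`-extension of the
number field `K`, `v ∣ p`, `ψ : Γ_{K_v} → ℤ_p` continuous additive with `ψ = a · (κ ∘ res_v)`, `u ∈ 𝒪_v` a unit (`|u|_v = 1`) and
`σ ∈ Γ_K` with `ε_p(σ) = N_{K_v/ℚ_p}(u)`. Then for EVERY continuous `2`-cocycle `c` of `ℤ_p(1)(K̄_v)` presented through the period line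
`ι : ℤ_p(1) → B_dR⁺(K_v)` by the cochain `τ ↦ ψ(τ) · ℓ_u` (`ℓ_u = unitKummerLog`, `IsCoboundaryLift (galRepr K_v p) (periodLine K_v p)`):
**`inv_∞[c] = −a · κ(σ)` in `ℤ_p`** (`cupProduct_kummerPadic_eq_twoCocycleClass_of_presentation` +
`invPadic_cupProduct_kummerPadic_eq_neg_mul_of_isCyclotomic`). Instances of `K_v` (`CharZero`, `Fact ¬IsUnit p`, `IsAdicComplete`,
`LocallyCompactSpace Γ`) are binders. [cite: Kato1993LNM1553, Ch. II §1.4.4 and Lemma 1.4.5] [cite: SerreLocalFields1979, XIV §1 Prop. 3] -/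
theorem invPadic_twoCocycleClass_eq_neg_mul_of_unitKummerLog_presentation (κ : ZpExtension K p) (hκ : κ.IsCyclotomic)
    (hpv : valuation (v.adicCompletion K) (p : v.adicCompletion K) < 1)
    (hF : Function.Surjective (fontaineTheta (integerC (v.adicCompletion K)) p)) (a : ℤ_[p])
    (ψ : C(absoluteGaloisGroup (v.adicCompletion K), ℤ_[p])) (hψ : ∀ σ τ, ψ (σ * τ) = ψ σ + ψ τ)
    (hψκ : ∀ τ, ψ τ = a * Multiplicative.toAdd (κ (absGaloisRestrict K (v.adicCompletion K) τ)))
    (u : v.adicCompletion K) (hu : u ≠ 0) (hu1 : valuation (v.adicCompletion K) u = 1) (σ : absoluteGaloisGroup K)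
    (hσ : letI := LocalField.padicAlgebra (v.adicCompletion K) p hpv
      (((GaloisRep.cyclotomicCharacter K p σ : ℤ_[p]ˣ) : ℤ_[p]) : ℚ_[p]) = Algebra.norm ℚ_[p] u)
    {c : contTwoCocycles (tateModuleMuPadic (v.adicCompletion K) p).toTopRep}
    (hc : IsCoboundaryLift (ρ := tateModuleMuPadic (v.adicCompletion K) p) (BdRPlusTop.galRepr (v.adicCompletion K) p)
      (BdRPlusTop.periodLine (v.adicCompletion K) p)
      (fun τ => BdRPlusTop.of (v.adicCompletion K) p (qpToBdR ((ψ τ : ℤ_[p]) : ℚ_[p])) *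
        BdRPlusTop.unitKummerLog hpv hF hu (norm_algebraMap_normedAlgClosure_le_one_of_valuation_le_one hu1.le)) c) :
    invPadic (v.adicCompletion K) p (twoCocycleClass _ c) = -(a * Multiplicative.toAdd (κ σ)) := by
  rw [← cupProduct_kummerPadic_eq_twoCocycleClass_of_presentation hpv hF hu
    (norm_algebraMap_normedAlgClosure_le_one_of_valuation_le_one hu1.le) (homOneCocycle (v.adicCompletion K) p ψ hψ) hc]
  exact invPadic_cupProduct_kummerPadic_eq_neg_mul_of_isCyclotomic κ hκ v hpv a ψ hψ hψκ u hu hu1 σ hσ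

end Completion

end Literature.NumberTheory.PAdicHodge

end
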